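import Summits.AtomisticToContinuum.Crystallization.Theses.PricedLinkCensus
import Summits.AtomisticToContinuum.Crystallization.Theorems.ChargedEnergyGap.Negative.PeriodicForm
import Summits.AtomisticToContinuum.Crystallization.Theorems.ChargedEnergyGap.Negative.PeriodicMinimisers
import Summits.AtomisticToContinuum.Crystallization.Theorems.ChargedEnergyGap.Negative.BarlowBlind
import Summits.AtomisticToContinuum.Crystallization.Theorems.PricedLinkCensusChargedEnergyGapDetect
import Summits.AtomisticToContinuum.Crystallization.Theorems.PricedLinkCensusChargedEnergyGapDetectNear
import Summits.AtomisticToContinuum.Crystallization.Theorems.PricedLinkCensusChargedEnergyGapRegularise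
import Summits.AtomisticToContinuum.Crystallization.Theorems.PricedLinkCensusChargedEnergyGapChargeRecount
import Summits.AtomisticToContinuum.Crystallization.Theorems.PricedLinkCensusChargedEnergyGapGrossFloorOfPeriodic
import Summits.AtomisticToContinuum.Crystallization.Theorems.PricedLinkCensusChargedEnergyGapPerturbativeOfCore
import Literature.MathematicalPhysics.StatisticalMechanics.BarlowStacking

/-!
# Line `barlow-relative-pricing` — crux `PricedLinkCensus.ChargedEnergyGap`
(item stmt-AtomisticToContinuum-14231), crux-plan round 1.

BARLOW-RELATIVE PRICING.  The crux prices link charge against the non-constructive constant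
`e* = ⨅_Q e_LJ(Q)`.  This line never mentions `e*`: it prices against the EXPLICIT Barlow
reference `eBarlow = ⨅ e_LJ(barlowPeriodicConfiguration a h s)` (all periodic Hägg words `s`,
all in-layer spacings `a`, all layer spacings `h` — the whole family the `1 %`-charge is blind to,
`ChargedEnergyGapNegative.isChargeFree_barlowStacking`), for which `e* ≤ eBarlow` is free
(`eStar_le_eBarlow` below, from the landed `ChargedEnergyGapNegative.eStar_le`).  The priced gap
relative to `eBarlow` is cut along the empirical threshold law `price ≈ 0.4·η²` (Disproof §7):

* GEOMETRY  (`stub_detect`): a site whose radius-`3·nn_i` environment is two-way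
  `(nn_i/500)`-matched to a rigid image of an ideal Barlow stacking of spacing `nn_i` (any Hägg
  word) is charge-free at tolerance `1/100` — so `#charged ≤ #(not (1/500,3)-Barlow-near)`;
* ENERGY, relative to `eBarlow` (four stubs after the lead's reshape of 2026-08-16): REGULARISATION AT THE
  CHARGE LEVEL (`stub_chargeRecount`: deleting one particle of an injective configuration raises the charged
  count by at most an absolute constant `F` — reverse-nearest-neighbour counting; `stub_regularise`: given the
  recount, closest-pair deletion — a squeezed site pays for its own removal — transfers a priced charge gap
  relative to ANY reference `e` from `1/3`-separated to all injective configurations, pattern of the proved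
  `ClosestPairDeletion` of the cousin crux StarCoercivity), PERTURBATIVE RELATIVE COERCIVITY (`stub_perturbative`: sites that are not
  `(1/500,3)`-near pay `c > 0` each above `N·eBarlow`, up to a debit `c'` per site that is not
  even `(1/40,3)`-near — uniform Cauchy–Born/phonon coercivity of the Barlow family with
  null-Lagrangian localisation and an interface debit), and the GROSS RELATIVE FLOOR
  (`stub_grossFloor`, the residue and hardest stub: sites that are not `(1/40,3)`-near pay
  `c_g > 0` each above `N·eBarlow` — contains `e* = eBarlow`, i.e. that the Barlow family solves
  the periodic Lennard-Jones problem, and a uniform gap for non-close-packed matter).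

`ChargedEnergyGap_of : PricedLinkCensus.ChargedEnergyGap` composes the stubs into the crux BY NAME, hypothesis-free
(weight `t = c_g/(c_g + |c'| + 1)` kills the debit; detection turns the separated relative coercivity into a separated
priced CHARGE gap relative to `e_B`; the regularisation runs at the charge level with reference `e = e_B`; finally
`e* ≤ e_B`), and `ChargedEnergyGap_of_periodic : PricedLinkCensus.ChargedEnergyGap` composes the PERIODIC stubs directly
(detection read in `Q.points` + the two periodic pricings ⇒ `PeriodicPricing (1/100) κ` relative to `e_B ≥ e*` ⇒ crux by the
landed `ChargedEnergyGapNegative.chargedEnergyGap_of_periodicPricing`, Negative V).  No `sorry` outside `stub_*`.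

STATUS 2026-08-16T11:00Z (lead gen 1, cycle 2 — RESHAPE 4, "periodic core").  LANDED under
`Theorems/PricedLinkCensusChargedEnergyGap*.lean` and IMPORTED here (no longer stubs of this file): `stub_detect` (p84788,
`BarlowRelativePricingDetect`), `stub_chargeRecount` (p85951, `BarlowRelativePricingRecount`), `stub_grossFloorOfPeriodic`
(p91023, `BarlowRelativePricingPeriodic`), `stub_perturbativeOfCore` (p92375, `BarlowRelativePricingPerturbative`; now a
remark), `stub_regularise` (p86708, `BarlowRelativePricingRegularise`), `stub_detectNear` (p96927,
`BarlowRelativePricingDetectNear`, reshape 4).  `stub_perturbativeOfPeriodic` is LANDED too (p97898,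
`BarlowRelativePricingPerturbativeTransfer`) and is kept as a `sorry` COPY below only until the farm snapshot serving Cruxes
workfiles has built its module; replace by the import when it is.  RESHAPE 4: the near-field core `stub_perturbativeCore`
(site-energy form on `δ₀`-separated finite configurations) is SUPERSEDED by its periodic form `stub_perturbativePeriodic`
(`PerturbativePeriodic`: every periodic `Q` pays `c > 0` per FINE motif point — `(1/40,3)`-near but not `(1/500,3)`-near in
`Q.points` — above `#motif·e_B`, up to a debit `C'` per GROSS motif point), so that BOTH open stubs are statements about
periodic configurations relative to the explicit `e_B` (the disprover's architecture, Negative V/VII; no boundary, no `δ₀`,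
Bloch/phonon methods apply; kill = one explicit periodic lattice sum); the finite statements follow by far periodisation
(`stub_perturbativeOfPeriodic`, provable now with the landed `near_of_near_image` / `near_image_of_near`, and the landed
`stub_grossFloorOfPeriodic`), and the old core `NearFieldCore` is recovered from them (`nearFieldCore_holds`, landed
`core_of_stub`).  NEW stub `stub_detectNear` (LANDED p96927 within the hour): detection for an ARBITRARY index type (in
particular the point set of a periodic configuration), the `Fin N` case being the landed `stub_detect`; the transfer
`stub_perturbativeOfPeriodic` LANDED as p97898.  So SEVEN stubs of this line are landed and exactly the two periodic pricings
remain.  OPEN and crux-sized: `stub_perturbativePeriodic`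
(uniform harmonic coercivity of the Barlow family — the perturbative theorem) and `stub_grossFloorPeriodic` (periodic gross
pricing; contains `e_B = e*`; handed back `promote-stub` by lead 0, signature unchanged).  The stub signatures are fully
inlined and qualified (so a `Theorems/`-side proof `--supports stmt-AtomisticToContinuum-14231` can restate them textually);
the readable local names (`IsBarlowNear`, `nonNear`, `eBarlow`, `PerturbativePeriodic`, …) are definitionally the inlined
forms (`*_holds` below are `:= stub_*`).
-/

noncomputable section

namespace Summit.AtomisticToContinuum.Crystallization.Cruxes.ChargedEnergyGap.BarlowRelativePricing

open Literature.MathematicalPhysics.StatisticalMechanics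
open Literature.Geometry.DiscreteGeometry
open Summit.AtomisticToContinuum.Crystallization.Theses.PricedLinkCensus
open Summit.AtomisticToContinuum.Crystallization.Theorems
open scoped BigOperators

/-- Ambient space `ℝ³`. -/
abbrev E3 : Type := EuclideanSpace ℝ (Fin 3)

/-! ## The Barlow reference energy -/

/-- Index of the periodic Barlow stackings: `(a, h, p, s)` with in-layer spacing `a ≠ 0`, layer spacing
`h ≠ 0` (FREE, not only the ideal `a√(2/3)`: relaxed LJ hcp has `c/a = 1.63276 ≠ 1.63299`), a period
`p ≠ 0` of the Hägg word `s`, and `IsHaggSeq s`.  A subtype of `ℝ × ℝ × ℕ × (ℤ → ℤ)` so that the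
reference is an expression over existing declarations only. -/
abbrev BarlowIdx : Type :=
  {t : ℝ × ℝ × ℕ × (ℤ → ℤ) // t.1 ≠ 0 ∧ t.2.1 ≠ 0 ∧ t.2.2.1 ≠ 0 ∧
    (∀ i : ℤ, t.2.2.2 (i + t.2.2.1) = t.2.2.2 i) ∧ IsHaggSeq t.2.2.2}

/-- The periodic configuration of an index (tree constructor `barlowPeriodicConfiguration`; its point set is
`barlowStacking a h s`, `barlowPeriodicConfiguration_points`). -/
def BarlowIdx.toPeriodic (P : BarlowIdx) : PeriodicConfiguration 3 :=
  barlowPeriodicConfiguration P.1.2.2.2 P.2.1 P.2.2.1 P.2.2.2.1 P.2.2.2.2.1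

/-- hcp with `a = h = 1` is an index. -/
def BarlowIdx.hcp : BarlowIdx :=
  ⟨(1, 1, 2, alternatingHagg), one_ne_zero, one_ne_zero, two_ne_zero, alternatingHagg_periodic,
    isHaggSeq_alternating⟩

instance : Nonempty BarlowIdx := ⟨BarlowIdx.hcp⟩

/-- **The Barlow reference energy** `e_B = ⨅` over periodic Barlow stackings (all Hägg words, all `a`, all
`h`) of the Lennard-Jones energy per particle: an explicit family of lattice sums (certifiable by interval
arithmetic) in place of the variational constant `e*`. -/
def eBarlow : ℝ := ⨅ P : BarlowIdx, P.toPeriodic.energyPerParticle lennardJones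

/-- The free direction: `e* ≤ e_B` (each Barlow stacking is a periodic competitor; periodic energies are
bounded below — landed `ChargedEnergyGapNegative.eStar_le`, i.e. item 0714 discharged). -/
theorem eStar_le_eBarlow :
    (⨅ Q : PeriodicConfiguration 3, Q.energyPerParticle lennardJones) ≤ eBarlow :=
  le_ciInf fun P => ChargedEnergyGapNegative.eStar_le P.toPeriodic

/-! ## Barlow-nearness at the site's own scale -/

/-- Site `i` of `y` is `(ε, R)`-BARLOW-NEAR: it has a positive own scale `nn_i = nearestDist y i`, the sites
of `y` within `R·nn_i` of `y i` are pairwise at least `nn_i / 2` apart (no doubled sites — without this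
clause `stub_detect` is false), and they are TWO-WAY `ε·nn_i`-matched with a rigid-motion image of an IDEAL
Barlow stacking of spacing `nn_i`, `barlowStacking nn_i (nn_i·√(2/3)) s`, for SOME Hägg word `s` (any word:
stacking must be invisible, `isChargeFree_barlowStacking`).  Scale-free and isometry-invariant like
`IsChargeFree`; signature shape of `SoftLayerPropagation`'s conclusion (radius 3, precision ε). -/
def IsBarlowNear (ε R : ℝ) {N : ℕ} (y : Fin N → E3) (i : Fin N) : Prop :=
  0 < nearestDist y i ∧
  (∀ j k : Fin N, j ≠ k → dist (y i) (y j) ≤ R * nearestDist y i →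
      dist (y i) (y k) ≤ R * nearestDist y i → nearestDist y i / 2 ≤ dist (y j) (y k)) ∧
  ∃ (s : ℤ → ℤ) (g : E3 ≃ᵃⁱ[ℝ] E3), IsHaggSeq s ∧
    (∀ j : Fin N, dist (y i) (y j) ≤ R * nearestDist y i →
      ∃ z ∈ barlowStacking (nearestDist y i) (nearestDist y i * Real.sqrt (2 / 3)) s,
        dist (y j) (g z) ≤ ε * nearestDist y i) ∧
    (∀ z ∈ barlowStacking (nearestDist y i) (nearestDist y i * Real.sqrt (2 / 3)) s,
      dist (y i) (g z) ≤ R * nearestDist y i → ∃ j : Fin N, dist (y j) (g z) ≤ ε * nearestDist y i)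

/-- Number of sites of `y` that are NOT `(ε, R)`-Barlow-near. -/
def nonNear (ε R : ℝ) {N : ℕ} (y : Fin N → E3) : ℕ :=
  Nat.card {i : Fin N // ¬ IsBarlowNear ε R y i}

/-- `δ₀`-SEPARATED configuration (distinct sites at distance `≥ δ₀`; for `δ₀ > 0` this implies injectivity):
the regularised class, as in the proved closest-pair deletion of the cousin line
`StarCoercivity/Lines/separation-padding-transfer` (there `δ₀ = 1/3`). -/
def IsSeparated (δ₀ : ℝ) {N : ℕ} (y : Fin N → E3) : Prop :=
  ∀ i j : Fin N, i ≠ j → δ₀ ≤ dist (y i) (y j)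

/-! ## The relative statements (readable forms) -/

/-- RELATIVE COERCIVITY on all injective configurations: sites that are not `(1/500, 3)`-near pay `c` each
above `N·e_B`, up to a sublinear allowance. -/
def RelCoercive : Prop :=
  ∃ c : ℝ, 0 < c ∧ ∃ C : ℝ, ∀ (N : ℕ) (y : Fin N → E3), Function.Injective y →
    (N : ℝ) * eBarlow + c * (nonNear (1 / 500) 3 y : ℝ) - C * (N : ℝ) ^ (2 / 3 : ℝ) ≤
      interactionEnergy lennardJones y

/-- The same on `δ₀`-separated configurations only. -/
def RelCoerciveSep (δ₀ : ℝ) : Prop :=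
  ∃ c : ℝ, 0 < c ∧ ∃ C : ℝ, ∀ (N : ℕ) (y : Fin N → E3), IsSeparated δ₀ y →
    (N : ℝ) * eBarlow + c * (nonNear (1 / 500) 3 y : ℝ) - C * (N : ℝ) ^ (2 / 3 : ℝ) ≤
      interactionEnergy lennardJones y

/-- PERTURBATIVE RELATIVE COERCIVITY on `δ₀`-separated configurations: fine non-nearness (resolution `1/500`)
costs `c > 0` per site above `N·e_B`, up to a debit `c'` per GROSSLY non-near site (resolution `1/40`) and a
sublinear allowance. -/
def PerturbativeSep (δ₀ : ℝ) : Prop :=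
  ∃ c : ℝ, 0 < c ∧ ∃ c' C : ℝ, ∀ (N : ℕ) (y : Fin N → E3), IsSeparated δ₀ y →
    (N : ℝ) * eBarlow + c * (nonNear (1 / 500) 3 y : ℝ) - c' * (nonNear (1 / 40) 3 y : ℝ) -
        C * (N : ℝ) ^ (2 / 3 : ℝ) ≤ interactionEnergy lennardJones y

/-- GROSS RELATIVE FLOOR on `δ₀`-separated configurations: grossly non-near sites (resolution `1/40`) cost
`c_g > 0` per site above `N·e_B`, up to a sublinear allowance. -/
def GrossFloorSep (δ₀ : ℝ) : Prop :=
  ∃ c : ℝ, 0 < c ∧ ∃ C : ℝ, ∀ (N : ℕ) (y : Fin N → E3), IsSeparated δ₀ y →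
    (N : ℝ) * eBarlow + c * (nonNear (1 / 40) 3 y : ℝ) - C * (N : ℝ) ^ (2 / 3 : ℝ) ≤
      interactionEnergy lennardJones y

/-- CHARGE RECOUNT under deletion of one particle (absolute constant `F`). -/
def ChargeRecount : Prop :=
  ∃ F : ℕ, ∀ (N : ℕ) (x : Fin (N + 1) → E3) (i₀ : Fin (N + 1)), Function.Injective x →
    Nat.card {i : Fin (N + 1) // ¬ IsChargeFree (1 / 100 : ℝ) x i} ≤
      Nat.card {i : Fin N // ¬ IsChargeFree (1 / 100 : ℝ) (x ∘ Fin.succAbove i₀) i} + F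

/-- PRICED CHARGE GAP relative to the reference energy `e`, on `1/3`-separated configurations. -/
def SepChargeGap (e : ℝ) : Prop :=
  ∃ κ : ℝ, 0 < κ ∧ ∃ C : ℝ, ∀ (N : ℕ) (y : Fin N → E3), IsSeparated (1 / 3) y →
    (N : ℝ) * e + κ * (Nat.card {i : Fin N // ¬ IsChargeFree (1 / 100 : ℝ) y i} : ℝ) -
        C * (N : ℝ) ^ (2 / 3 : ℝ) ≤ interactionEnergy lennardJones y

/-- PRICED CHARGE GAP relative to the reference energy `e`, on all injective configurations. -/
def ChargeGap (e : ℝ) : Prop :=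
  ∃ κ : ℝ, 0 < κ ∧ ∃ C : ℝ, ∀ (N : ℕ) (y : Fin N → E3), Function.Injective y →
    (N : ℝ) * e + κ * (Nat.card {i : Fin N // ¬ IsChargeFree (1 / 100 : ℝ) y i} : ℝ) -
        C * (N : ℝ) ^ (2 / 3 : ℝ) ≤ interactionEnergy lennardJones y

/-- Barlow-nearness read in a configuration with an ARBITRARY index type (e.g. the point set of a periodic
configuration); for `ι = Fin N` it is `IsBarlowNear` (`Iff.rfl`). -/
def IsBarlowNearι (ε R : ℝ) {ι : Type*} (y : ι → E3) (i : ι) : Prop :=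
  0 < nearestDist y i ∧
  (∀ j k : ι, j ≠ k → dist (y i) (y j) ≤ R * nearestDist y i →
      dist (y i) (y k) ≤ R * nearestDist y i → nearestDist y i / 2 ≤ dist (y j) (y k)) ∧
  ∃ (s : ℤ → ℤ) (g : E3 ≃ᵃⁱ[ℝ] E3), IsHaggSeq s ∧
    (∀ j : ι, dist (y i) (y j) ≤ R * nearestDist y i →
      ∃ z ∈ barlowStacking (nearestDist y i) (nearestDist y i * Real.sqrt (2 / 3)) s,
        dist (y j) (g z) ≤ ε * nearestDist y i) ∧
    (∀ z ∈ barlowStacking (nearestDist y i) (nearestDist y i * Real.sqrt (2 / 3)) s,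
      dist (y i) (g z) ≤ R * nearestDist y i → ∃ j : ι, dist (y j) (g z) ≤ ε * nearestDist y i)

/-- `IsBarlowNear` is the `Fin N` case of `IsBarlowNearι`. -/
theorem isBarlowNear_iff_ι (ε R : ℝ) {N : ℕ} (y : Fin N → E3) (i : Fin N) :
    IsBarlowNear ε R y i ↔ IsBarlowNearι ε R y i := Iff.rfl

/-- Number of GROSS motif sites of a periodic configuration: motif points that are not `(1/40, 3)`-Barlow-near,
nearness read in the infinite point set `Q.points` (cf. the disprover's `motifCharged`). -/
def motifGross (Q : PeriodicConfiguration 3) : ℕ :=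
  Nat.card {x : Q.motif //
    ¬ IsBarlowNearι (1 / 40) 3 (Subtype.val : Q.points → E3) ⟨x.1, Q.mem_points_of_mem_motif x.2⟩}

/-- PERIODIC GROSS PRICING: every periodic configuration pays `c > 0` per gross motif site above `e_B`
(cf. the disprover's `PeriodicPricing η κ` with `e*`). -/
def GrossPeriodic : Prop :=
  ∃ c : ℝ, 0 < c ∧ ∀ Q : PeriodicConfiguration 3,
    c * (motifGross Q : ℝ) ≤ (Q.motif.card : ℝ) * (Q.energyPerParticle lennardJones - eBarlow)

/-- THE NEAR-FIELD CORE (site-energy form of the harmonic species): on `δ₀`-separated configurations, the half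
site energies of the `(1/40,3)`-near sites exceed `e_B` in the sum by `c` per `(1/40,3)`-near-but-not-`(1/500,3)`-near
site, up to a debit `C'` per gross site and a sublinear allowance. -/
def NearFieldCore (δ₀ : ℝ) : Prop :=
  ∃ c : ℝ, 0 < c ∧ ∃ C' C : ℝ, ∀ (N : ℕ) (y : Fin N → E3), IsSeparated δ₀ y →
    c * (Nat.card {i : Fin N // IsBarlowNear (1 / 40) 3 y i ∧ ¬ IsBarlowNear (1 / 500) 3 y i} : ℝ) -
        C' * (nonNear (1 / 40) 3 y : ℝ) - C * (N : ℝ) ^ (2 / 3 : ℝ) ≤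
      ∑ i : Fin N, Set.indicator {i : Fin N | IsBarlowNear (1 / 40) 3 y i}
        (fun i : Fin N => (1 / 2 : ℝ) * siteEnergy lennardJones y i - eBarlow) i

/-- Number of FINE motif sites of a periodic configuration: motif points that are `(1/40, 3)`-Barlow-near but not
`(1/500, 3)`-Barlow-near, nearness read in the infinite point set `Q.points` (the harmonic species: `0.2 %`–`2.5 %`
own-scale chart mismatch over radius `3`). -/
def motifFine (Q : PeriodicConfiguration 3) : ℕ :=
  Nat.card {x : Q.motif //
    IsBarlowNearι (1 / 40) 3 (Subtype.val : Q.points → E3) ⟨x.1, Q.mem_points_of_mem_motif x.2⟩ ∧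
      ¬ IsBarlowNearι (1 / 500) 3 (Subtype.val : Q.points → E3) ⟨x.1, Q.mem_points_of_mem_motif x.2⟩}

/-- Number of motif sites of a periodic configuration that are NOT `(1/500, 3)`-Barlow-near in `Q.points`
(fine or gross). -/
def motifNonNear (Q : PeriodicConfiguration 3) : ℕ :=
  Nat.card {x : Q.motif //
    ¬ IsBarlowNearι (1 / 500) 3 (Subtype.val : Q.points → E3) ⟨x.1, Q.mem_points_of_mem_motif x.2⟩}

/-- PERIODIC PERTURBATIVE PRICING (the harmonic species, periodic form): every periodic configuration pays `c > 0`
per fine motif site above `#motif · e_B`, up to a debit `C'` per gross motif site.  For an everywhere-`(1/40,3)`-near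
`Q` (no gross sites) it says `e(Q) ≥ e_B + c·(fine fraction)`: uniform phonon / Cauchy–Born coercivity of every
near-ideal Barlow stacking about its own optimal uniform scale, counted sitewise at the own-scale threshold `nn/500`. -/
def PerturbativePeriodic : Prop :=
  ∃ c : ℝ, 0 < c ∧ ∃ C' : ℝ, ∀ Q : PeriodicConfiguration 3,
    c * (motifFine Q : ℝ) - C' * (motifGross Q : ℝ) ≤
      (Q.motif.card : ℝ) * (Q.energyPerParticle lennardJones - eBarlow)

/-- BARLOW-RELATIVE PERIODIC PRICING (the transfer `C⁺` in periodic form): every periodic configuration pays `κ > 0` per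
motif site that is not `(1/500,3)`-Barlow-near, above `#motif · e_B`. -/
def BarlowPeriodicPricing : Prop :=
  ∃ κ : ℝ, 0 < κ ∧ ∀ Q : PeriodicConfiguration 3,
    κ * (motifNonNear Q : ℝ) ≤ (Q.motif.card : ℝ) * (Q.energyPerParticle lennardJones - eBarlow)

/-! ## The registered stubs (`sorry` lives only in the `stub_*` theorems; signatures fully inlined and
qualified, definitionally equal to the readable forms — see `*_holds`) -/

/-- **stub_perturbativePeriodic** (THE HARMONIC SPECIES IN PERIODIC FORM; XL; open — reshape 4 by lead gen 1, supersedes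
the near-field core `stub_perturbativeCore`).  Every periodic configuration `Q` of `ℝ³` pays `c > 0` per FINE motif point
(`(1/40,3)`-near but not `(1/500,3)`-near, read in `Q.points`) above `#motif · e_B`, up to a debit `C'` per GROSS motif
point (`PerturbativePeriodic`, inlined).  Content, for an everywhere-`(1/40,3)`-near `Q` (then `Q.points` is globally a
`≤ 2.5 %`-distorted Barlow stacking `s` with periodic distortion): (i) `e_s(a, h) ≥ e_B` at every uniform scale (definition
of `e_B`); (ii) UNIFORM harmonic (acoustic + optical) stability of every Barlow stacking about its optimal uniform
`(a_s, h_s)` — Bloch reduction to a `6p × 6p` Hermitian family over the Brillouin zone, uniformly in the Hägg word (all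
layers are identical triangular nets with identical inter-layer springs; templates HudsonOrtner2011, SchmidtSteinbach2022,
tree item `ExcessDecayLiouville.PhononStability` 9333 = the hcp window only); (iii) anharmonic control on the `2.5 %` basin
(`½V″ε² ≈ 1.9e-3` vs `⅙|V‴|ε³ ≈ 3.3e-4` at `ε = 2.5 %`); (iv) own-scale chart rigidity: a motif point not `(1/500,3)`-near inside
`2.5 %`-Barlow material carries strain `≳ 5e-4` in its `3`-ball, energy `≥ ½λ_min(5e-4)² ≈ 1e-6 =: c` (the zero modes —
rigid motions, dilation, stacking word — are exactly the freedoms of `IsBarlowNearι`); (v) polytypes with inequivalent layers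
relax non-uniformly by `~1e-9 ≪ e_dhcp − e_hcp = 3.7e-5`, so (i) survives relaxation.  With gross sites present: cross terms
across near/gross frontiers are debited `C' = O(1)` per gross site (`r⁻⁶` tail of `nn/2`-separated matter beyond `3nn`;
uncancelled first-order terms live within `3nn` of gross matter).  KILL = certificate: a periodic `Q` with no gross site,
fine fraction `θ_f > 0` and `e(Q) − e_B < c·θ_f` for every `c > 0`, e.g. a `≤ 2.5 %`-distorted Barlow structure with
`e(Q) ≤ e_B` (none known: threshold strain `0.2 %/3` costs `≈ 1e-5`/site, `c/a` off by `7e-4` costs `≈ 1.3e-5`, inner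
displacement is a stiff optical mode).  Degenerate `Q` (one motif point, cubic images; coincident-free by `PeriodicConfiguration`)
are all-gross: the inequality reads `−C' ≤ e(Q) − e_B`, true for `C' ≥ |e_B| + B_stab`. -/
theorem stub_perturbativePeriodic : let near : ℝ → (ι : Type) → (ι → EuclideanSpace ℝ (Fin 3)) → ι → Prop := fun ε ι y i => 0 < Literature.Geometry.DiscreteGeometry.nearestDist y i ∧ (∀ j k : ι, j ≠ k → dist (y i) (y j) ≤ 3 * Literature.Geometry.DiscreteGeometry.nearestDist y i → dist (y i) (y k) ≤ 3 * Literature.Geometry.DiscreteGeometry.nearestDist y i → Literature.Geometry.DiscreteGeometry.nearestDist y i / 2 ≤ dist (y j) (y k)) ∧ ∃ (s : ℤ → ℤ) (g : EuclideanSpace ℝ (Fin 3) ≃ᵃⁱ[ℝ] EuclideanSpace ℝ (Fin 3)), Literature.MathematicalPhysics.StatisticalMechanics.IsHaggSeq s ∧ (∀ j : ι, dist (y i) (y j) ≤ 3 * Literature.Geometry.DiscreteGeometry.nearestDist y i → ∃ z ∈ Literature.MathematicalPhysics.StatisticalMechanics.barlowStacking (Literature.Geometry.DiscreteGeometry.nearestDist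 y i) (Literature.Geometry.DiscreteGeometry.nearestDist y i * Real.sqrt (2 / 3)) s, dist (y j) (g z) ≤ ε * Literature.Geometry.DiscreteGeometry.nearestDist y i) ∧ (∀ z ∈ Literature.MathematicalPhysics.StatisticalMechanics.barlowStacking (Literature.Geometry.DiscreteGeometry.nearestDist y i) (Literature.Geometry.DiscreteGeometry.nearestDist y i * Real.sqrt (2 / 3)) s, dist (y i) (g z) ≤ 3 * Literature.Geometry.DiscreteGeometry.nearestDist y i → ∃ j : ι, dist (y j) (g z) ≤ ε * Literature.Geometry.DiscreteGeometry.nearestDist y i); let eB : ℝ := ⨅ P : {t : ℝ × ℝ × ℕ × (ℤ → ℤ) // t.1 ≠ 0 ∧ t.2.1 ≠ 0 ∧ t.2.2.1 ≠ 0 ∧ (∀ i : ℤ, t.2.2.2 (i + t.2.2.1) = t.2.2.2 i) ∧ Literature.MathematicalPhysics.StatisticalMechanics.IsHaggSeq t.2.2.2}, (Literature.MathematicalPhysics.StatisticalMechanics.barlowPeriodicConfiguration P.1.2.2.2 P.2.1 P.2.2.1 P.2.2.2.1 P.2.2.2.2.1).energyPerParticle Literature.MathematicalPhysics.StatisticalMechanics.lennardJones;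 ∃ c : ℝ, 0 < c ∧ ∃ C' : ℝ, ∀ Q : Literature.MathematicalPhysics.StatisticalMechanics.PeriodicConfiguration 3, c * (Nat.card {x : Q.motif // near (1 / 40) Q.points (Subtype.val : Q.points → EuclideanSpace ℝ (Fin 3)) ⟨x.1, Q.mem_points_of_mem_motif x.2⟩ ∧ ¬ near (1 / 500) Q.points (Subtype.val : Q.points → EuclideanSpace ℝ (Fin 3)) ⟨x.1, Q.mem_points_of_mem_motif x.2⟩} : ℝ) - C' * (Nat.card {x : Q.motif // ¬ near (1 / 40) Q.points (Subtype.val : Q.points → EuclideanSpace ℝ (Fin 3)) ⟨x.1, Q.mem_points_of_mem_motif x.2⟩} : ℝ) ≤ (Q.motif.card : ℝ) * (Q.energyPerParticle Literature.MathematicalPhysics.StatisticalMechanics.lennardJones - eB) := by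
  sorry

/-- **stub_perturbativeOfPeriodic** (TRANSFER periodic ⇒ finite for the harmonic species; M; LANDED p97898 `Theorems/PricedLinkCensusChargedEnergyGapPerturbativeOfPeriodic.lean`, decl `BarlowRelativePricingPerturbativeTransfer.stub_perturbativeOfPeriodic` — `sorry` copy kept until the module is built on the farm snapshot; reshape 4).  The
periodic perturbative pricing implies `PerturbativeSep δ₀` for every `δ₀ > 0` (indeed for all injective `y`, with `C =
c + |C'| + max e_B 0`): periodise an injective `y` (`N ≥ 2`) far apart (`ChargedEnergyGapNegative.periodiseFar`, period
`8D + 8`, `motif = {yᵢ}`, `e(Q_y)·N ≤ E(y)` by `energyPerParticle_periodise_le`); at the motif points `toPoint y _ i`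
nearness in `Q_y.points` at BOTH resolutions is nearness in `y` (landed `BarlowRelativePricingPeriodic.near_of_near_image` /
`near_image_of_near` with `nearestDist_toPoint`, `exists_toPoint_eq_of_dist_le`), so `#fine(y) ≤ #fine(Q_y)` and
`#gross(Q_y) ≤ #gross(y)`; with `nonNear (1/500) = fine + gross` (disjointly: `(1/500,3)`-near ⇒ `(1/40,3)`-near, landed
`BarlowRelativePricingPerturbative.near_mono`) one gets `N·e_B + c·nonNear(1/500) − (c + |C'|)·nonNear(1/40) ≤ N·e(Q_y) ≤ E(y)`;
`N ≤ 1`: `E = 0`, counts `≤ N`, absorbed by `C·N^(2/3)`.  Pattern: the landed `floor_of_periodic` (one count) with a second,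
oppositely signed count. -/
theorem stub_perturbativeOfPeriodic : let near : ℝ → (ι : Type) → (ι → EuclideanSpace ℝ (Fin 3)) → ι → Prop := fun ε ι y i => 0 < Literature.Geometry.DiscreteGeometry.nearestDist y i ∧ (∀ j k : ι, j ≠ k → dist (y i) (y j) ≤ 3 * Literature.Geometry.DiscreteGeometry.nearestDist y i → dist (y i) (y k) ≤ 3 * Literature.Geometry.DiscreteGeometry.nearestDist y i → Literature.Geometry.DiscreteGeometry.nearestDist y i / 2 ≤ dist (y j) (y k)) ∧ ∃ (s : ℤ → ℤ) (g : EuclideanSpace ℝ (Fin 3) ≃ᵃⁱ[ℝ] EuclideanSpace ℝ (Fin 3)), Literature.MathematicalPhysics.StatisticalMechanics.IsHaggSeq s ∧ (∀ j : ι, dist (y i) (y j) ≤ 3 * Literature.Geometry.DiscreteGeometry.nearestDist y i → ∃ z ∈ Literature.MathematicalPhysics.StatisticalMechanics.barlowStacking (Literature.Geometry.DiscreteGeometry.nearestDist y i) (Literature.Geometry.DiscreteGeometry.nearestDist y i * Real.sqrt (2 / 3)) s, dist (y j) (g z) ≤ ε * Literature.Geometry.DiscreteGeometry.nearestDist y i)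 ∧ (∀ z ∈ Literature.MathematicalPhysics.StatisticalMechanics.barlowStacking (Literature.Geometry.DiscreteGeometry.nearestDist y i) (Literature.Geometry.DiscreteGeometry.nearestDist y i * Real.sqrt (2 / 3)) s, dist (y i) (g z) ≤ 3 * Literature.Geometry.DiscreteGeometry.nearestDist y i → ∃ j : ι, dist (y j) (g z) ≤ ε * Literature.Geometry.DiscreteGeometry.nearestDist y i); let eB : ℝ := ⨅ P : {t : ℝ × ℝ × ℕ × (ℤ → ℤ) // t.1 ≠ 0 ∧ t.2.1 ≠ 0 ∧ t.2.2.1 ≠ 0 ∧ (∀ i : ℤ, t.2.2.2 (i + t.2.2.1) = t.2.2.2 i) ∧ Literature.MathematicalPhysics.StatisticalMechanics.IsHaggSeq t.2.2.2}, (Literature.MathematicalPhysics.StatisticalMechanics.barlowPeriodicConfiguration P.1.2.2.2 P.2.1 P.2.2.1 P.2.2.2.1 P.2.2.2.2.1).energyPerParticle Literature.MathematicalPhysics.StatisticalMechanics.lennardJones; (∃ c : ℝ, 0 < c ∧ ∃ C' : ℝ, ∀ Q : Literature.MathematicalPhysics.StatisticalMechanics.PeriodicConfiguration 3, c * (Nat.card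 {x : Q.motif // near (1 / 40) Q.points (Subtype.val : Q.points → EuclideanSpace ℝ (Fin 3)) ⟨x.1, Q.mem_points_of_mem_motif x.2⟩ ∧ ¬ near (1 / 500) Q.points (Subtype.val : Q.points → EuclideanSpace ℝ (Fin 3)) ⟨x.1, Q.mem_points_of_mem_motif x.2⟩} : ℝ) - C' * (Nat.card {x : Q.motif // ¬ near (1 / 40) Q.points (Subtype.val : Q.points → EuclideanSpace ℝ (Fin 3)) ⟨x.1, Q.mem_points_of_mem_motif x.2⟩} : ℝ) ≤ (Q.motif.card : ℝ) * (Q.energyPerParticle Literature.MathematicalPhysics.StatisticalMechanics.lennardJones - eB)) → ∀ δ₀ : ℝ, 0 < δ₀ → ∃ c : ℝ, 0 < c ∧ ∃ c' C : ℝ, ∀ (N : ℕ) (y : Fin N → EuclideanSpace ℝ (Fin 3)), (∀ i j : Fin N, i ≠ j → δ₀ ≤ dist (y i) (y j)) → (N : ℝ) * eB + c * (Nat.card {i : Fin N // ¬ near (1 / 500) (Fin N) y i} : ℝ) - c' * (Nat.card {i : Fin N // ¬ near (1 / 40) (Fin N) y i} : ℝ) - C * (N : ℝ) ^ (2 / 3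 : ℝ) ≤ Literature.MathematicalPhysics.StatisticalMechanics.interactionEnergy Literature.MathematicalPhysics.StatisticalMechanics.lennardJones y := by
  sorry

/-- **stub_grossFloorPeriodic** (THE RESIDUE IN PERIODIC FORM; open-problem content; hardest; the lead's — reshape
2026-08-16).  Every periodic configuration `Q` of `ℝ³` pays `c_g > 0` per GROSS motif site (a motif point that is not
`(1/40, 3)`-Barlow-near, nearness read in the infinite point set `Q.points`) above the Barlow reference:
`c_g · #gross(Q) ≤ #motif · (e(Q) − e_B)` (`GrossPeriodic`, inlined).  With `#gross ≥ 0` it contains `e(Q) ≥ e_B` for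
EVERY periodic `Q`, i.e. `e* = e_B` (`eBarlow_eq_eStar_of_grossPeriodic` below): the Barlow family solves the
periodic Lennard-Jones problem — energetic crystallization IN VALUE against an explicit family of lattice sums
(BlancLewin2015 §2.3: open in `d = 3`) — plus a uniform price for non-close-packed / grossly distorted periodic
matter (vacancy `≈ 4e-3` per gross site, bcc / A15 / C15 `≥ 3e-2`, `0.8 %` homogeneous strain `≈ 4e-4`; polytypes,
faults, twins free AND near).  KILL = certificate: ONE periodic `Q` with `e(Q) < e_B` (both sides explicit lattice
sums), or gross periodic `Q_n` with `(e(Q_n) − e_B)·#motif/#gross → 0`.  Shape = the disprover's `PeriodicPricing`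
(Negative V/VII: `ChargedEnergyGap ↔ ∃ κ > 0, PeriodicPricing (1/100) κ`) with `e_B` for `e*` and gross
non-nearness for charge. -/
theorem stub_grossFloorPeriodic : ∃ c : ℝ, 0 < c ∧ ∀ Q : Literature.MathematicalPhysics.StatisticalMechanics.PeriodicConfiguration 3, c * (Nat.card {x : Q.motif // ¬ (0 < Literature.Geometry.DiscreteGeometry.nearestDist (Subtype.val : Q.points → EuclideanSpace ℝ (Fin 3)) ⟨x.1, Q.mem_points_of_mem_motif x.2⟩ ∧ (∀ j k : Q.points, j ≠ k → dist ((Subtype.val : Q.points → EuclideanSpace ℝ (Fin 3)) ⟨x.1, Q.mem_points_of_mem_motif x.2⟩) ((Subtype.val : Q.points → EuclideanSpace ℝ (Fin 3)) j) ≤ 3 * Literature.Geometry.DiscreteGeometry.nearestDist (Subtype.val : Q.points → EuclideanSpace ℝ (Fin 3)) ⟨x.1, Q.mem_points_of_mem_motif x.2⟩ → dist ((Subtype.val : Q.points → EuclideanSpace ℝ (Fin 3)) ⟨x.1, Q.mem_points_of_mem_motif x.2⟩) ((Subtype.val : Q.points → EuclideanSpace ℝ (Fin 3)) k) ≤ 3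 * Literature.Geometry.DiscreteGeometry.nearestDist (Subtype.val : Q.points → EuclideanSpace ℝ (Fin 3)) ⟨x.1, Q.mem_points_of_mem_motif x.2⟩ → Literature.Geometry.DiscreteGeometry.nearestDist (Subtype.val : Q.points → EuclideanSpace ℝ (Fin 3)) ⟨x.1, Q.mem_points_of_mem_motif x.2⟩ / 2 ≤ dist ((Subtype.val : Q.points → EuclideanSpace ℝ (Fin 3)) j) ((Subtype.val : Q.points → EuclideanSpace ℝ (Fin 3)) k)) ∧ ∃ (s : ℤ → ℤ) (g : EuclideanSpace ℝ (Fin 3) ≃ᵃⁱ[ℝ] EuclideanSpace ℝ (Fin 3)), Literature.MathematicalPhysics.StatisticalMechanics.IsHaggSeq s ∧ (∀ j : Q.points, dist ((Subtype.val : Q.points → EuclideanSpace ℝ (Fin 3)) ⟨x.1, Q.mem_points_of_mem_motif x.2⟩) ((Subtype.val : Q.points → EuclideanSpace ℝ (Fin 3)) j) ≤ 3 * Literature.Geometry.DiscreteGeometry.nearestDist (Subtype.val : Q.points → EuclideanSpace ℝ (Fin 3)) ⟨x.1, Q.mem_points_of_mem_motif x.2⟩ → ∃ z ∈ Literature.MathematicalPhysics.StatisticalMechanics.barlowStacking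 (Literature.Geometry.DiscreteGeometry.nearestDist (Subtype.val : Q.points → EuclideanSpace ℝ (Fin 3)) ⟨x.1, Q.mem_points_of_mem_motif x.2⟩) (Literature.Geometry.DiscreteGeometry.nearestDist (Subtype.val : Q.points → EuclideanSpace ℝ (Fin 3)) ⟨x.1, Q.mem_points_of_mem_motif x.2⟩ * Real.sqrt (2 / 3)) s, dist ((Subtype.val : Q.points → EuclideanSpace ℝ (Fin 3)) j) (g z) ≤ (1 / 40 : ℝ) * Literature.Geometry.DiscreteGeometry.nearestDist (Subtype.val : Q.points → EuclideanSpace ℝ (Fin 3)) ⟨x.1, Q.mem_points_of_mem_motif x.2⟩) ∧ (∀ z ∈ Literature.MathematicalPhysics.StatisticalMechanics.barlowStacking (Literature.Geometry.DiscreteGeometry.nearestDist (Subtype.val : Q.points → EuclideanSpace ℝ (Fin 3)) ⟨x.1, Q.mem_points_of_mem_motif x.2⟩) (Literature.Geometry.DiscreteGeometry.nearestDist (Subtype.val : Q.points → EuclideanSpace ℝ (Fin 3)) ⟨x.1, Q.mem_points_of_mem_motif x.2⟩ * Real.sqrt (2 / 3)) s, dist ((Subtype.val : Q.points → EuclideanSpace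 ℝ (Fin 3)) ⟨x.1, Q.mem_points_of_mem_motif x.2⟩) (g z) ≤ 3 * Literature.Geometry.DiscreteGeometry.nearestDist (Subtype.val : Q.points → EuclideanSpace ℝ (Fin 3)) ⟨x.1, Q.mem_points_of_mem_motif x.2⟩ → ∃ j : Q.points, dist ((Subtype.val : Q.points → EuclideanSpace ℝ (Fin 3)) j) (g z) ≤ (1 / 40 : ℝ) * Literature.Geometry.DiscreteGeometry.nearestDist (Subtype.val : Q.points → EuclideanSpace ℝ (Fin 3)) ⟨x.1, Q.mem_points_of_mem_motif x.2⟩))} : ℝ) ≤ (Q.motif.card : ℝ) * (Q.energyPerParticle Literature.MathematicalPhysics.StatisticalMechanics.lennardJones - (⨅ P : {t : ℝ × ℝ × ℕ × (ℤ → ℤ) // t.1 ≠ 0 ∧ t.2.1 ≠ 0 ∧ t.2.2.1 ≠ 0 ∧ (∀ i : ℤ, t.2.2.2 (i + t.2.2.1) = t.2.2.2 i) ∧ Literature.MathematicalPhysics.StatisticalMechanics.IsHaggSeq t.2.2.2}, (Literature.MathematicalPhysics.StatisticalMechanics.barlowPeriodicConfiguration P.1.2.2.2 P.2.1 P.2.2.1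 P.2.2.2.1 P.2.2.2.2.1).energyPerParticle Literature.MathematicalPhysics.StatisticalMechanics.lennardJones)) := by
  sorry

/-! ### The landed stubs (imported) and consistency: each readable statement IS its stub (definitionally) -/

/-- `stub_detect`, LANDED p84788. -/
theorem detect_holds :
    ∀ (N : ℕ) (y : Fin N → E3) (i : Fin N), IsBarlowNear (1 / 500) 3 y i → IsChargeFree (1 / 100 : ℝ) y i :=
  BarlowRelativePricingDetect.stub_detect

/-- `stub_detectNear`, LANDED p96927 (reshape 4; detection for an arbitrary index type), in readable form. -/
theorem detectNear_holds :
    ∀ (ι : Type) (y : ι → E3) (i : ι), IsBarlowNearι (1 / 500) 3 y i → IsChargeFree (1 / 100 : ℝ) y i :=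
  BarlowRelativePricingDetectNear.stub_detectNear

/-- `stub_chargeRecount`, LANDED p85951. -/
theorem chargeRecount_holds : ChargeRecount :=
  BarlowRelativePricingRecount.stub_chargeRecount

/-- `stub_regularise`, LANDED p86708, in readable form. -/
theorem regularise_holds : ChargeRecount → ∀ e : ℝ, SepChargeGap e → ChargeGap e :=
  BarlowRelativePricingRegularise.stub_regularise

/-- `stub_perturbativePeriodic` in readable form. -/
theorem perturbativePeriodic_holds : PerturbativePeriodic :=
  stub_perturbativePeriodic

/-- `stub_perturbativeOfPeriodic` in readable form. -/
theorem perturbativeOfPeriodic_holds : PerturbativePeriodic → ∀ δ₀ : ℝ, 0 < δ₀ → PerturbativeSep δ₀ :=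
  stub_perturbativeOfPeriodic

/-- The harmonic species on separated finite configurations. -/
theorem perturbative_holds : ∀ δ₀ : ℝ, 0 < δ₀ → PerturbativeSep δ₀ :=
  perturbativeOfPeriodic_holds perturbativePeriodic_holds

/-- The old near-field core (reshape 3) is recovered: LANDED `core_of_stub` (p92375, the converse direction of
`stub_perturbativeOfCore`). -/
theorem nearFieldCore_holds : ∀ δ₀ : ℝ, 0 < δ₀ → NearFieldCore δ₀ :=
  BarlowRelativePricingPerturbative.core_of_stub perturbative_holds

/-- And conversely the landed glue `stub_perturbativeOfCore` (p92375) turns the core back into the harmonic species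
(recorded so that the landed module stays in the cone). -/
theorem perturbative_of_core (h : ∀ δ₀ : ℝ, 0 < δ₀ → NearFieldCore δ₀) : ∀ δ₀ : ℝ, 0 < δ₀ → PerturbativeSep δ₀ :=
  BarlowRelativePricingPerturbative.stub_perturbativeOfCore h

/-- `stub_grossFloorPeriodic` in readable form. -/
theorem grossFloorPeriodic_holds : GrossPeriodic :=
  stub_grossFloorPeriodic

/-- `stub_grossFloorOfPeriodic`, LANDED p91023. -/
theorem grossFloorOfPeriodic_holds : GrossPeriodic → ∀ δ₀ : ℝ, 0 < δ₀ → GrossFloorSep δ₀ :=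
  BarlowRelativePricingPeriodic.stub_grossFloorOfPeriodic

/-- The gross floor on separated finite configurations. -/
theorem grossFloor_holds : ∀ δ₀ : ℝ, 0 < δ₀ → GrossFloorSep δ₀ :=
  grossFloorOfPeriodic_holds grossFloorPeriodic_holds

/-! ## Composition (no `sorry` below this line) -/

/-- Perturbative coercivity plus the gross floor give relative coercivity on separated configurations: the
weight `t = c_g/(c_g + |c'| + 1)` kills the debit. -/
theorem relCoerciveSep_of {δ₀ : ℝ} (hP : PerturbativeSep δ₀) (hG : GrossFloorSep δ₀) :
    RelCoerciveSep δ₀ := by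
  obtain ⟨c, hc, c', C₁, hP⟩ := hP
  obtain ⟨g, hg, C₂, hG⟩ := hG
  have hden : 0 < g + |c'| + 1 := by positivity
  set t : ℝ := g / (g + |c'| + 1) with ht
  have ht0 : 0 < t := div_pos hg hden
  have ht1 : t ≤ 1 := by
    rw [ht, div_le_one hden]
    linarith [abs_nonneg c']
  have hkey : 0 ≤ (1 - t) * g - t * c' := by
    have h1 : (1 - t) * g - t * c' ≥ (1 - t) * g - t * |c'| := by
      nlinarith [le_abs_self c', ht0.le]
    have h2 : (1 - t) * g - t * |c'| = g / (g + |c'| + 1) := by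
      rw [ht]
      field_simp
      ring
    have h3 : 0 < g / (g + |c'| + 1) := div_pos hg hden
    linarith
  refine ⟨t * c, mul_pos ht0 hc, t * C₁ + (1 - t) * C₂, ?_⟩
  intro N y hR
  have h1 := hP N y hR
  have h2 := hG N y hR
  have hG0 : (0 : ℝ) ≤ (nonNear (1 / 40) 3 y : ℝ) := Nat.cast_nonneg _
  have h1' := mul_le_mul_of_nonneg_left h1 ht0.le
  have h2' := mul_le_mul_of_nonneg_left h2 (sub_nonneg.2 ht1)
  have h3 := mul_nonneg hkey hG0
  nlinarith [h1', h2', h3]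

/-- Charged sites are not `(1/500, 3)`-near (contrapositive of the detection statement), so the charge count is
dominated by the non-nearness count. -/
theorem card_charged_le_nonNear
    (hdet : ∀ (N : ℕ) (y : Fin N → E3) (i : Fin N),
      IsBarlowNear (1 / 500) 3 y i → IsChargeFree (1 / 100 : ℝ) y i)
    {N : ℕ} (y : Fin N → E3) :
    Nat.card {i : Fin N // ¬ IsChargeFree (1 / 100 : ℝ) y i} ≤ nonNear (1 / 500) 3 y := by
  unfold nonNear
  have hsub : {i : Fin N | ¬ IsChargeFree (1 / 100 : ℝ) y i} ⊆
      {i : Fin N | ¬ IsBarlowNear (1 / 500) 3 y i} :=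
    fun i hi hnear => hi (hdet N y i hnear)
  exact Nat.card_mono (Set.toFinite _) hsub

/-- Detection turns the separated relative coercivity into a separated priced CHARGE gap relative to `e_B`
(`#charged ≤ nonNear (1/500) 3`). -/
theorem sepChargeGap_of (hdet : ∀ (N : ℕ) (y : Fin N → E3) (i : Fin N),
      IsBarlowNear (1 / 500) 3 y i → IsChargeFree (1 / 100 : ℝ) y i)
    (hco : RelCoerciveSep (1 / 3)) : SepChargeGap eBarlow := by
  obtain ⟨c, hc, C, hco⟩ := hco
  refine ⟨c, hc, C, fun N y hy => ?_⟩
  have hmono : (Nat.card {i : Fin N // ¬ IsChargeFree (1 / 100 : ℝ) y i} : ℝ) ≤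
      (nonNear (1 / 500) 3 y : ℝ) := by
    exact_mod_cast card_charged_le_nonNear hdet y
  have hc' := mul_le_mul_of_nonneg_left hmono hc.le
  linarith [hco N y hy]

/-- The logic of the line: detection + recount + regularisation + perturbative coercivity + gross floor ⇒ the
BODY of the crux (landed vocabulary `ChargedEnergyGapNegative.GapWith (1/100) κ C`; the crux is this by `Iff.rfl`,
`ChargedEnergyGapNegative.chargedEnergyGap_iff`): separated relative coercivity at `δ₀ = 1/3` (weighting), separated
charge gap relative to `e_B` (detection), charge gap relative to `e_B` on all injective configurations
(regularisation with reference `e = e_B`), and `e* ≤ e_B`. -/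
theorem gapWith_of_hyps
    (hdet : ∀ (N : ℕ) (y : Fin N → E3) (i : Fin N),
      IsBarlowNear (1 / 500) 3 y i → IsChargeFree (1 / 100 : ℝ) y i)
    (hrec : ChargeRecount)
    (hreg : ChargeRecount → ∀ e : ℝ, SepChargeGap e → ChargeGap e)
    (hpert : ∀ δ₀ : ℝ, 0 < δ₀ → PerturbativeSep δ₀)
    (hgross : ∀ δ₀ : ℝ, 0 < δ₀ → GrossFloorSep δ₀) :
    ∃ κ C : ℝ, 0 < κ ∧ ChargedEnergyGapNegative.GapWith (1 / 100) κ C := by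
  have h3 : (0 : ℝ) < 1 / 3 := by norm_num
  have hsep : SepChargeGap eBarlow :=
    sepChargeGap_of hdet (relCoerciveSep_of (hpert _ h3) (hgross _ h3))
  obtain ⟨κ, hκ, C, hgap⟩ := hreg hrec eBarlow hsep
  refine ⟨κ, C, hκ, ?_⟩
  show ∀ (N : ℕ) (y : Fin N → E3), Function.Injective y →
    (N : ℝ) * (⨅ Q : PeriodicConfiguration 3, Q.energyPerParticle lennardJones) +
        κ * (Nat.card {i : Fin N // ¬ IsChargeFree (1 / 100 : ℝ) y i} : ℝ) -
        C * (N : ℝ) ^ (2 / 3 : ℝ) ≤ interactionEnergy lennardJones y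
  intro N y hy
  have hE := hgap N y hy
  have heB : (N : ℝ) * (⨅ Q : PeriodicConfiguration 3, Q.energyPerParticle lennardJones) ≤
      (N : ℝ) * eBarlow :=
    mul_le_mul_of_nonneg_left eStar_le_eBarlow (Nat.cast_nonneg N)
  linarith

/-- **COMPOSITION, BY NAME (finite route).**  The registered stubs (with the landed ones) imply the crux
`PricedLinkCensus.ChargedEnergyGap`; hypothesis-free, no `sorry` outside `stub_*`.  Cone: detect (landed),
chargeRecount (landed), regularise (landed), perturbativePeriodic + perturbativeOfPeriodic, grossFloorPeriodic +
grossFloorOfPeriodic (landed). -/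
theorem ChargedEnergyGap_of :
    Summit.AtomisticToContinuum.Crystallization.Theses.PricedLinkCensus.ChargedEnergyGap :=
  ChargedEnergyGapNegative.chargedEnergyGap_iff.2
    (gapWith_of_hyps detect_holds chargeRecount_holds regularise_holds perturbative_holds
      grossFloor_holds)

/-! ## The periodic route (reshape 4): both pricings are periodic, so compose them in periodic form and
finish with the landed `chargedEnergyGap_of_periodicPricing` (Negative V) — no separation, no recount. -/

/-- A motif site that is not `(1/500,3)`-near is fine or gross: `#nonNear ≤ #fine + #gross`. -/
theorem motifNonNear_le (Q : PeriodicConfiguration 3) : motifNonNear Q ≤ motifFine Q + motifGross Q := by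
  classical
  unfold motifNonNear motifFine motifGross
  rw [← Nat.card_sum]
  refine Nat.card_le_card_of_injective
    (fun x => if h : IsBarlowNearι (1 / 40) 3 (Subtype.val : Q.points → E3)
        ⟨x.1.1, Q.mem_points_of_mem_motif x.1.2⟩ then Sum.inl ⟨x.1, h, x.2⟩ else Sum.inr ⟨x.1, h⟩)
    ?_
  intro a b hab
  by_cases ha : IsBarlowNearι (1 / 40) 3 (Subtype.val : Q.points → E3) ⟨a.1.1, Q.mem_points_of_mem_motif a.1.2⟩
  <;> by_cases hb : IsBarlowNearι (1 / 40) 3 (Subtype.val : Q.points → E3) ⟨b.1.1, Q.mem_points_of_mem_motif b.1.2⟩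
  <;> simp only [ha, hb, dif_pos, dif_neg, not_false_eq_true, Sum.inl.injEq, Sum.inr.injEq,
    reduceCtorEq, Subtype.mk.injEq] at hab
  <;> exact Subtype.ext hab

/-- The two periodic pricings give the Barlow-relative periodic pricing: with `t = g/(g + |C'| + 1)`,
`t·(c·F − C'·G) + (1 − t)·g·G ≥ min(t·c, (1−t)·g − t·C')·(F + G) ≥ κ·#nonNear`. -/
theorem barlowPeriodicPricing_of (hP : PerturbativePeriodic) (hG : GrossPeriodic) : BarlowPeriodicPricing := by
  obtain ⟨c, hc, C', hP⟩ := hP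
  obtain ⟨g, hg, hG⟩ := hG
  have hden : 0 < g + |C'| + 1 := by positivity
  set t : ℝ := g / (g + |C'| + 1) with ht
  have ht0 : 0 < t := div_pos hg hden
  have ht1 : t ≤ 1 := by
    rw [ht, div_le_one hden]
    linarith [abs_nonneg C']
  have hkey : t ≤ (1 - t) * g - t * C' := by
    have h1 : (1 - t) * g - t * C' ≥ (1 - t) * g - t * |C'| := by
      nlinarith [le_abs_self C', ht0.le]
    have h2 : (1 - t) * g - t * |C'| = g / (g + |C'| + 1) := by
      rw [ht]
      field_simp
      ring
    linarith
  refine ⟨min (t * c) t, lt_min (mul_pos ht0 hc) ht0, fun Q => ?_⟩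
  have h1 := hP Q
  have h2 := hG Q
  have hF0 : (0 : ℝ) ≤ (motifFine Q : ℝ) := Nat.cast_nonneg _
  have hG0 : (0 : ℝ) ≤ (motifGross Q : ℝ) := Nat.cast_nonneg _
  have hN0 : (0 : ℝ) ≤ (motifNonNear Q : ℝ) := Nat.cast_nonneg _
  have hle : (motifNonNear Q : ℝ) ≤ (motifFine Q : ℝ) + (motifGross Q : ℝ) := by
    exact_mod_cast motifNonNear_le Q
  have h1' := mul_le_mul_of_nonneg_left h1 ht0.le
  have h2' := mul_le_mul_of_nonneg_left h2 (sub_nonneg.2 ht1)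
  have hm1 : min (t * c) t ≤ t * c := min_le_left _ _
  have hm2 : min (t * c) t ≤ t := min_le_right _ _
  have hm0 : 0 ≤ min (t * c) t := (lt_min (mul_pos ht0 hc) ht0).le
  have hA : min (t * c) t * (motifNonNear Q : ℝ) ≤
      (t * c) * (motifFine Q : ℝ) + ((1 - t) * g - t * C') * (motifGross Q : ℝ) := by
    calc min (t * c) t * (motifNonNear Q : ℝ)
        ≤ min (t * c) t * ((motifFine Q : ℝ) + (motifGross Q : ℝ)) :=
          mul_le_mul_of_nonneg_left hle hm0
      _ = min (t * c) t * (motifFine Q : ℝ) + min (t * c) t * (motifGross Q : ℝ) := by ring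
      _ ≤ (t * c) * (motifFine Q : ℝ) + ((1 - t) * g - t * C') * (motifGross Q : ℝ) :=
          add_le_add (mul_le_mul_of_nonneg_right hm1 hF0)
            (mul_le_mul_of_nonneg_right (hm2.trans hkey) hG0)
  nlinarith [h1', h2', hA]

/-- Detection read in the point set of a periodic configuration: charged motif sites are not
`(1/500,3)`-near, so `motifCharged (1/100) Q ≤ motifNonNear Q`. -/
theorem motifCharged_le_motifNonNear
    (hdet : ∀ (ι : Type) (y : ι → E3) (i : ι), IsBarlowNearι (1 / 500) 3 y i → IsChargeFree (1 / 100 : ℝ) y i)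
    (Q : PeriodicConfiguration 3) :
    ChargedEnergyGapNegative.motifCharged (1 / 100) Q ≤ motifNonNear Q := by
  unfold ChargedEnergyGapNegative.motifCharged motifNonNear
  exact Nat.card_mono (Set.toFinite _) fun x hx hnear => hx (hdet _ _ _ hnear)

/-- The Barlow-relative periodic pricing plus detection give the disprover's `PeriodicPricing (1/100) κ`
(relative to `e*`, using the free direction `e* ≤ e_B`). -/
theorem periodicPricing_of
    (hdet : ∀ (ι : Type) (y : ι → E3) (i : ι), IsBarlowNearι (1 / 500) 3 y i → IsChargeFree (1 / 100 : ℝ) y i)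
    (h : BarlowPeriodicPricing) :
    ∃ κ : ℝ, 0 < κ ∧ ChargedEnergyGapNegative.PeriodicPricing (1 / 100) κ := by
  obtain ⟨κ, hκ, h⟩ := h
  refine ⟨κ, hκ, fun Q => ?_⟩
  have hc : (ChargedEnergyGapNegative.motifCharged (1 / 100) Q : ℝ) ≤ (motifNonNear Q : ℝ) := by
    exact_mod_cast motifCharged_le_motifNonNear hdet Q
  have hm : (0 : ℝ) ≤ Q.motif.card := Nat.cast_nonneg _
  have h0 : ChargedEnergyGapNegative.eStar ≤ eBarlow := eStar_le_eBarlow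
  have he : (Q.motif.card : ℝ) * (Q.energyPerParticle lennardJones - eBarlow) ≤
      (Q.motif.card : ℝ) * (Q.energyPerParticle lennardJones - ChargedEnergyGapNegative.eStar) :=
    mul_le_mul_of_nonneg_left (by linarith) hm
  have hk := mul_le_mul_of_nonneg_left hc hκ.le
  linarith [h Q]

/-- **COMPOSITION, BY NAME (periodic route).**  Detection for arbitrary index types + the two periodic
pricings imply the crux, via the landed `chargedEnergyGap_of_periodicPricing` (Negative V). -/
theorem ChargedEnergyGap_of_periodic :
    Summit.AtomisticToContinuum.Crystallization.Theses.PricedLinkCensus.ChargedEnergyGap := by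
  obtain ⟨κ, hκ, h⟩ :=
    periodicPricing_of detectNear_holds (barlowPeriodicPricing_of perturbativePeriodic_holds grossFloorPeriodic_holds)
  exact ChargedEnergyGapNegative.chargedEnergyGap_of_periodicPricing hκ h

/-! ## Other entries (kernel-checked; not registered) -/

/-- **What the residue contains**: the periodic gross pricing forces `e(Q) ≥ e_B` for EVERY periodic `Q`
(`#gross ≥ 0`, `#motif > 0`), hence `e_B = e*` — the Barlow family attains the periodic Lennard-Jones infimum
(energetic crystallization in value, open in `d = 3`).  This is why `stub_grossFloorPeriodic` is crux-sized. -/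
theorem eBarlow_eq_eStar_of_grossPeriodic (h : GrossPeriodic) :
    eBarlow = ⨅ Q : PeriodicConfiguration 3, Q.energyPerParticle lennardJones := by
  obtain ⟨c, hc, h⟩ := h
  refine le_antisymm (le_ciInf fun Q => ?_) eStar_le_eBarlow
  have hQ := h Q
  have hm : (0 : ℝ) < Q.motif.card := by exact_mod_cast Q.motif_nonempty.card_pos
  have hg : (0 : ℝ) ≤ c * (motifGross Q : ℝ) := mul_nonneg hc.le (Nat.cast_nonneg _)
  nlinarith

/-- THE TRANSFER `C⁺`: the Barlow-relative priced gap (the crux with the explicit `e_B` in place of `e*`). -/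
def BarlowRelativeGap : Prop :=
  ∃ κ C : ℝ, 0 < κ ∧ ∀ (N : ℕ) (y : Fin N → E3), Function.Injective y →
    (N : ℝ) * eBarlow + κ * (Nat.card {i : Fin N // ¬ IsChargeFree (1 / 100 : ℝ) y i} : ℝ) -
        C * (N : ℝ) ^ (2 / 3 : ℝ) ≤ interactionEnergy lennardJones y

/-- `C⁺ ⇒` the body of the crux (the free direction `e* ≤ e_B`); with
`ChargedEnergyGapNegative.chargedEnergyGap_iff.2` this is `C⁺ ⇒ crux`. -/
theorem gapWith_of_barlowRelativeGap (h : BarlowRelativeGap) :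
    ∃ κ C : ℝ, 0 < κ ∧ ChargedEnergyGapNegative.GapWith (1 / 100) κ C := by
  obtain ⟨κ, C, hκ, h⟩ := h
  refine ⟨κ, C, hκ, ?_⟩
  show ∀ (N : ℕ) (y : Fin N → E3), Function.Injective y →
    (N : ℝ) * (⨅ Q : PeriodicConfiguration 3, Q.energyPerParticle lennardJones) +
        κ * (Nat.card {i : Fin N // ¬ IsChargeFree (1 / 100 : ℝ) y i} : ℝ) -
        C * (N : ℝ) ^ (2 / 3 : ℝ) ≤ interactionEnergy lennardJones y
  intro N y hy
  have heB : (N : ℝ) * (⨅ Q : PeriodicConfiguration 3, Q.energyPerParticle lennardJones) ≤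
      (N : ℝ) * eBarlow :=
    mul_le_mul_of_nonneg_left eStar_le_eBarlow (Nat.cast_nonneg N)
  linarith [h N y hy]

/-- Detection + relative coercivity give `C⁺` (so the line proves `C⁺`, not only the crux). -/
theorem barlowRelativeGap_of (hdet : ∀ (N : ℕ) (y : Fin N → E3) (i : Fin N),
      IsBarlowNear (1 / 500) 3 y i → IsChargeFree (1 / 100 : ℝ) y i) (hco : RelCoercive) :
    BarlowRelativeGap := by
  obtain ⟨c, hc, C, hco⟩ := hco
  refine ⟨c, C, hc, fun N y hy => ?_⟩
  have hmono : (Nat.card {i : Fin N // ¬ IsChargeFree (1 / 100 : ℝ) y i} : ℝ) ≤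
      (nonNear (1 / 500) 3 y : ℝ) := by
    exact_mod_cast card_charged_le_nonNear hdet y
  have hc' := mul_le_mul_of_nonneg_left hmono hc.le
  linarith [hco N y hy]

/-- With the reshaped stubs: detection + recount + regularisation + separated relative coercivity give `C⁺`. -/
theorem barlowRelativeGap_of_sep (hdet : ∀ (N : ℕ) (y : Fin N → E3) (i : Fin N),
      IsBarlowNear (1 / 500) 3 y i → IsChargeFree (1 / 100 : ℝ) y i)
    (hrec : ChargeRecount) (hreg : ChargeRecount → ∀ e : ℝ, SepChargeGap e → ChargeGap e)
    (hco : RelCoerciveSep (1 / 3)) : BarlowRelativeGap := by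
  obtain ⟨κ, hκ, C, h⟩ := hreg hrec eBarlow (sepChargeGap_of hdet hco)
  exact ⟨κ, C, hκ, h⟩

/-- **Hard-core reduction of the crux itself** (reference `e = e*`): by the landed recount and regularisation, a
priced charge gap on `1/3`-SEPARATED configurations relative to `e*` already gives the BODY of `ChargedEnergyGap`
(`ChargedEnergyGapNegative.chargedEnergyGap_iff.2` turns it into the crux; cf. line
`defect-zoom-compactness`'s `stub_hardCoreReduction`, here with separation `1/3` and obtained for free). -/
theorem gapWith_of_sepChargeGap_eStar
    (h : SepChargeGap (⨅ Q : PeriodicConfiguration 3, Q.energyPerParticle lennardJones)) :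
    ∃ κ C : ℝ, 0 < κ ∧ ChargedEnergyGapNegative.GapWith (1 / 100) κ C := by
  obtain ⟨κ, hκ, C, hgap⟩ := regularise_holds chargeRecount_holds _ h
  exact ⟨κ, C, hκ, hgap⟩

/-! ## Sanity of the two periodic pricings on the blind family (kernel-checked, reshape 4) -/

/-- `(a√(2/3))² = ⅔a²`. -/
theorem sq_mul_sqrt_two_thirds (a : ℝ) : (a * Real.sqrt (2 / 3)) ^ 2 = 2 / 3 * a ^ 2 := by
  rw [mul_pow, Real.sq_sqrt (by norm_num : (0 : ℝ) ≤ 2 / 3)]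
  ring

/-- `e_B ≤ e(P)` for every Barlow index `P` (all periodic energies are bounded below by `e*`). -/
theorem eBarlow_le (P : BarlowIdx) : eBarlow ≤ P.toPeriodic.energyPerParticle lennardJones :=
  ciInf_le ⟨⨅ Q : PeriodicConfiguration 3, Q.energyPerParticle lennardJones, by
    rintro _ ⟨P', rfl⟩
    exact ChargedEnergyGapNegative.eStar_le _⟩ P

/-- Barlow-nearness is invariant under re-indexing the sites by an equivalence. -/
theorem isBarlowNearι_comp_equiv {ι κ : Type*} (ε R : ℝ) (y : ι → E3) (e : κ ≃ ι) (j : κ) :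
    IsBarlowNearι ε R (y ∘ e) j ↔ IsBarlowNearι ε R y (e j) := by
  unfold IsBarlowNearι
  rw [nearestDist_comp_equiv]
  simp only [Function.comp_apply]
  constructor
  · rintro ⟨h0, hsep, s, g, hs, h1, h2⟩
    refine ⟨h0, fun j' k' hjk hj hk => ?_, s, g, hs, fun j' hj => ?_, fun z hz hzi => ?_⟩
    · have := hsep (e.symm j') (e.symm k') (by simpa using hjk) (by simpa using hj) (by simpa using hk)
      simpa using this
    · obtain ⟨z, hz, hd⟩ := h1 (e.symm j') (by simpa using hj)
      exact ⟨z, hz, by simpa using hd⟩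
    · obtain ⟨j', hj'⟩ := h2 z hz hzi
      exact ⟨e j', hj'⟩
  · rintro ⟨h0, hsep, s, g, hs, h1, h2⟩
    refine ⟨h0, fun j' k' hjk hj hk => hsep (e j') (e k') (by simpa using hjk) hj hk, s, g, hs,
      fun j' hj => h1 (e j') hj, fun z hz hzi => ?_⟩
    obtain ⟨j', hj'⟩ := h2 z hz hzi
    exact ⟨e.symm j', by simpa using hj'⟩

/-- Every point of an ideal Barlow stacking (`h = a√(2/3)`) is `(ε, R)`-Barlow-near for every `ε ≥ 0` and
every `R`: chart = the stacking itself, `g = 1`, own scale `a` (`Barlow.nearestDist_eq`), separation from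
`le_dist_of_mem_barlowStacking_ideal`. -/
theorem isBarlowNearι_ideal {a : ℝ} {s : ℤ → ℤ} (hs : IsHaggSeq s) (ha : 0 < a) {ε : ℝ} (hε : 0 ≤ ε)
    (R : ℝ) (p : barlowStacking a (a * Real.sqrt (2 / 3)) s) :
    IsBarlowNearι ε R (Subtype.val : barlowStacking a (a * Real.sqrt (2 / 3)) s → E3) p := by
  have hh := sq_mul_sqrt_two_thirds a
  have hnn : nearestDist (Subtype.val : barlowStacking a (a * Real.sqrt (2 / 3)) s → E3) p = a :=
    ChargedEnergyGapNegative.Barlow.nearestDist_eq hs ha hh p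
  unfold IsBarlowNearι
  rw [hnn]
  refine ⟨ha, fun j k hjk _ _ => ?_, s, AffineIsometryEquiv.refl ℝ E3, hs, fun j _ => ⟨j.1, j.2, ?_⟩,
    fun z hz _ => ⟨⟨z, hz⟩, ?_⟩⟩
  · have := le_dist_of_mem_barlowStacking_ideal hs ha hh j.2 k.2 fun h' => hjk (Subtype.ext h')
    linarith
  · simp only [AffineIsometryEquiv.coe_refl, id_eq, dist_self]
    exact mul_nonneg hε ha.le
  · simp only [AffineIsometryEquiv.coe_refl, id_eq, dist_self]
    exact mul_nonneg hε ha.le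

/-- Hence every point of the periodic configuration of a periodic Hägg word at the ideal spacing
(`ChargedEnergyGapNegative.idealBarlowQ`) is `(ε, R)`-Barlow-near in its point set. -/
theorem isBarlowNearι_idealBarlowQ {a : ℝ} {s : ℤ → ℤ} {p : ℕ} (hs : IsHaggSeq s) (ha : 0 < a)
    (hp : p ≠ 0) (hper : ∀ i, s (i + p) = s i) {ε : ℝ} (hε : 0 ≤ ε) (R : ℝ)
    (q : (ChargedEnergyGapNegative.idealBarlowQ ha (sq_mul_sqrt_two_thirds a) hp hper).points) :
    IsBarlowNearι ε R
      (Subtype.val : (ChargedEnergyGapNegative.idealBarlowQ ha (sq_mul_sqrt_two_thirds a) hp hper).points → E3)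
      q := by
  have hpts := ChargedEnergyGapNegative.idealBarlowQ_points ha (sq_mul_sqrt_two_thirds a) hp hper
  let e : barlowStacking a (a * Real.sqrt (2 / 3)) s ≃
      (ChargedEnergyGapNegative.idealBarlowQ ha (sq_mul_sqrt_two_thirds a) hp hper).points :=
    Equiv.setCongr hpts.symm
  have hcomp : (Subtype.val :
      (ChargedEnergyGapNegative.idealBarlowQ ha (sq_mul_sqrt_two_thirds a) hp hper).points → E3) ∘ e =
      (Subtype.val : barlowStacking a (a * Real.sqrt (2 / 3)) s → E3) := by
    funext x
    rfl
  have := (isBarlowNearι_comp_equiv ε R _ e (e.symm q)).1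
    (by rw [hcomp]; exact isBarlowNearι_ideal hs ha hε R _)
  simpa using this

/-- **The two periodic pricings hold, with room, on the whole blind family.**  At the periodic configuration
of every periodic Hägg word at the ideal spacing and every scale `a > 0` there is no fine, no gross and no
non-near motif site, and `e(Q) ≥ e_B` (it is a Barlow index); so `stub_perturbativePeriodic` and
`stub_grossFloorPeriodic` read `0 ≤ #motif · (e(Q) − e_B)` there, for EVERY `c`, `C'` — the analogue of the
disprover's `periodicPricing_at_idealBarlowQ` (Negative IX) for the `e_B`-relative pricings. -/
theorem pricings_at_idealBarlowQ {a : ℝ} {s : ℤ → ℤ} {p : ℕ} (hs : IsHaggSeq s) (ha : 0 < a) (hp : p ≠ 0)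
    (hper : ∀ i, s (i + p) = s i) (c C' : ℝ) :
    motifFine (ChargedEnergyGapNegative.idealBarlowQ ha (sq_mul_sqrt_two_thirds a) hp hper) = 0 ∧
    motifGross (ChargedEnergyGapNegative.idealBarlowQ ha (sq_mul_sqrt_two_thirds a) hp hper) = 0 ∧
    motifNonNear (ChargedEnergyGapNegative.idealBarlowQ ha (sq_mul_sqrt_two_thirds a) hp hper) = 0 ∧
    c * (motifFine (ChargedEnergyGapNegative.idealBarlowQ ha (sq_mul_sqrt_two_thirds a) hp hper) : ℝ) -
        C' * (motifGross (ChargedEnergyGapNegative.idealBarlowQ ha (sq_mul_sqrt_two_thirds a) hp hper) : ℝ) ≤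
      ((ChargedEnergyGapNegative.idealBarlowQ ha (sq_mul_sqrt_two_thirds a) hp hper).motif.card : ℝ) *
        ((ChargedEnergyGapNegative.idealBarlowQ ha (sq_mul_sqrt_two_thirds a) hp hper).energyPerParticle
          lennardJones - eBarlow) ∧
    c * (motifGross (ChargedEnergyGapNegative.idealBarlowQ ha (sq_mul_sqrt_two_thirds a) hp hper) : ℝ) ≤
      ((ChargedEnergyGapNegative.idealBarlowQ ha (sq_mul_sqrt_two_thirds a) hp hper).motif.card : ℝ) *
        ((ChargedEnergyGapNegative.idealBarlowQ ha (sq_mul_sqrt_two_thirds a) hp hper).energyPerParticle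
          lennardJones - eBarlow) := by
  set Q := ChargedEnergyGapNegative.idealBarlowQ ha (sq_mul_sqrt_two_thirds a) hp hper with hQ
  have hnear : ∀ ε : ℝ, 0 ≤ ε → ∀ q : Q.points, IsBarlowNearι ε 3 (Subtype.val : Q.points → E3) q :=
    fun ε hε q => isBarlowNearι_idealBarlowQ hs ha hp hper hε 3 q
  have hF : motifFine Q = 0 := by
    unfold motifFine
    haveI : IsEmpty {x : Q.motif //
        IsBarlowNearι (1 / 40) 3 (Subtype.val : Q.points → E3) ⟨x.1, Q.mem_points_of_mem_motif x.2⟩ ∧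
          ¬ IsBarlowNearι (1 / 500) 3 (Subtype.val : Q.points → E3) ⟨x.1, Q.mem_points_of_mem_motif x.2⟩} :=
      ⟨fun x => x.2.2 (hnear _ (by norm_num) _)⟩
    exact Nat.card_of_isEmpty
  have hG : motifGross Q = 0 := by
    unfold motifGross
    haveI : IsEmpty {x : Q.motif //
        ¬ IsBarlowNearι (1 / 40) 3 (Subtype.val : Q.points → E3) ⟨x.1, Q.mem_points_of_mem_motif x.2⟩} :=
      ⟨fun x => x.2 (hnear _ (by norm_num) _)⟩
    exact Nat.card_of_isEmpty
  have hN : motifNonNear Q = 0 := by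
    unfold motifNonNear
    haveI : IsEmpty {x : Q.motif //
        ¬ IsBarlowNearι (1 / 500) 3 (Subtype.val : Q.points → E3) ⟨x.1, Q.mem_points_of_mem_motif x.2⟩} :=
      ⟨fun x => x.2 (hnear _ (by norm_num) _)⟩
    exact Nat.card_of_isEmpty
  have he : eBarlow ≤ Q.energyPerParticle lennardJones :=
    eBarlow_le ⟨(a, a * Real.sqrt (2 / 3), p, s), ha.ne',
      ChargedEnergyGapNegative.h_ne_zero ha (sq_mul_sqrt_two_thirds a), hp, hper, hs⟩
  have hm : (0 : ℝ) ≤ Q.motif.card := Nat.cast_nonneg _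
  have h0 : (0 : ℝ) ≤ (Q.motif.card : ℝ) * (Q.energyPerParticle lennardJones - eBarlow) :=
    mul_nonneg hm (sub_nonneg.2 he)
  refine ⟨hF, hG, hN, ?_, ?_⟩
  · rw [hF, hG, Nat.cast_zero, mul_zero, mul_zero, sub_zero]
    exact h0
  · rw [hG, Nat.cast_zero, mul_zero]
    exact h0

/-! ## Scratch checks against the standing Disproof / landed Negative lemmas -/

/-- The crux is the strict positivity of `κ_max(1/100)` (landed part VIII); this line produces the explicit lower
bound `κ_max(1/100) ≥ κ` once the stubs close. -/
example : ChargedEnergyGap ↔ 0 < ChargedEnergyGapNegative.kappaMax (1 / 100) :=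
  ChargedEnergyGapNegative.chargedEnergyGap_iff_kappaMax_pos

/-- Tolerance is load-bearing (landed part VI, unconditional): any proof must use `1/100 > 0` quantitatively —
this line does so in `stub_detect` only (`4.02/500 < 1/100`). -/
example {κ : ℝ} (hκ : 0 < κ) (C : ℝ) : ¬ ChargedEnergyGapNegative.GapWith 0 κ C :=
  ChargedEnergyGapNegative.not_gapWith_of_eta_nonpos' le_rfl hκ C

/-- Blindness honoured: the reference family is exactly the charge-free ideal Barlow family (landed part IX),
so `e_B` is the largest reference a charge pricing can afford. -/
example {a h : ℝ} {s : ℤ → ℤ} (hs : IsHaggSeq s) (ha : 0 < a) (hh : h ^ 2 = 2 / 3 * a ^ 2)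
    (p : barlowStacking a h s) :
    IsChargeFree (1 / 100 : ℝ) (Subtype.val : barlowStacking a h s → E3) p :=
  ChargedEnergyGapNegative.Barlow.isChargeFree_barlowStacking hs ha hh (by norm_num)
    ChargedEnergyGapNegative.Barlow.one_add_lt_sqrt_two p

end Summit.AtomisticToContinuum.Crystallization.Cruxes.ChargedEnergyGap.BarlowRelativePricing

end
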